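import Literature.Algebra.Homology.HopfTraceFormula
import Mathlib.Algebra.Homology.Homotopy
import Mathlib.Algebra.Homology.QuasiIso
import HarnessLib

/-!
# The Lefschetz number of an endomorphism of Mathlib's `HomologicalComplex`

Layer `Literature/Algebra/Homology` (pure linear algebra over Mathlib; ONE data-valued definition + proved theorems, 0 named
facts, no instances, no notation). For a homological complex `C` of vector spaces over a field `K`, of ANY shape `c` with
`ComplexShape.EulerCharSigns`, and an endomorphism `φ : C ⟶ C`, the **Lefschetz number** (Hatcher §2.C, Spanier 4.7)

  `lefschetzNumber φ := Σᶠ i, χ(i) • tr(H(φ)ᵢ : Hᵢ(C) → Hᵢ(C)) ∈ K`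

(a `finsum`: the honest signed sum when the homology is finite-dimensional and finitely supported, else `0`). Contents:
* `lefschetzNumber_eq_finsum_χ_smul_trace_f` — **Hopf**: `Λ(φ) = Σᶠ i, χ(i) • tr(φᵢ)` for finite-dimensional finitely
  supported TERMS (row `HopfTraceFormula` read through the definition; `Finset` and `ℤ`-`Icc` cochain forms);
* `lefschetzNumber_id` — `Λ(𝟙 C) = χ_H(C)` (Mathlib's `homologyEulerChar`, cast to `K`);
* `Homotopy.lefschetzNumber_eq` — homotopic endomorphisms have the same Lefschetz number;
* `lefschetzNumber_comp_comm` — `Λ(φ ≫ ψ) = Λ(ψ ≫ φ)` for `φ : C ⟶ D`, `ψ : D ⟶ C`;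
* `lefschetzNumber_eq_of_comm_quasiIso` — invariance under quasi-isomorphic replacement: `f : C ⟶ D` a quasi-isomorphism with
  `φ ≫ f = f ≫ ψ` ⇒ `Λ(φ) = Λ(ψ)`; `lefschetzNumber_conj` — conjugation by an isomorphism of complexes;
* additivity in `φ`: `lefschetzNumber_zero / _neg / _add / _sub / _smul`;
* vanishing: `lefschetzNumber_eq_zero_of_exactAt` (acyclic complexes), `Homotopy.lefschetzNumber_eq_zero` (null-homotopic
  endomorphisms) and its chain-level shadow `finsum_χ_smul_trace_f_eq_zero_of_homotopy_zero` (super-trace `0`).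

NOT this definition / statement (different objects, named for the dedup record): `Geometry/Kaehler/ComplexTorusLefschetzNumber`
(`ComplexTorus.lefschetzNumber (A : Matrix ι ι ℤ) : ℚ`, exterior powers of an integer matrix) and its
`AlgebraicGeometry/HodgeTheory/AbelianVariety*Lefschetz*` consumers; `AlgebraicGeometry/Motives/Sweep2` (`lefschetzNumberForm` on
correspondences); `AlgebraicGeometry/Motives/CorrespondenceAlgebraModNumericalSemisimple` (`gradedTrace` on a Weil cohomology's
graded pieces); `Analysis/InnerProduct/HilbertComplexLefschetzSupertrace`; `AlgebraicGeometry/HodgeTheory/HomComplexSupertrace`;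
`Algebra/Homology/GroupCohomologyPullbackTrace` (`tr(α^*|Hⁿ) = tr(α_*|Hₙ)` for group (co)homology). Mathlib has no Lefschetz
number of a chain map (its «Lefschetz» is the model-theoretic principle).
Library only (cell `pub-hodge-ring2`, count-neutral); proves nothing about any crux, route or conjecture.

## References

* A. Hatcher, *Algebraic Topology* (2002), §2.C: the Lefschetz number `τ(f) = Σₙ (−1)ⁿ tr(f_* : Hₙ(X) → Hₙ(X))` and
  Thm. 2C.3 (Hopf trace formula). [HatcherAT2002]
* E. H. Spanier, *Algebraic Topology* (1981), Ch. 4 §7 (Lefschetz number of a chain map, Thm. 6). [Spanier1981]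
-/

open CategoryTheory CategoryTheory.Limits

universe v u w

namespace Literature.Algebra.Homology.Lefschetz

variable {K : Type u} [Field K] {ι : Type w} {c : ComplexShape ι} [c.EulerCharSigns]
variable {C D : HomologicalComplex (ModuleCat.{v} K) c}

/-- **The Lefschetz number** `Λ(φ) = Σᶠ i, χ(i) • tr(H(φ)ᵢ)` of an endomorphism `φ` of a homological complex of vector spaces
(signs from `ComplexShape.EulerCharSigns`; a `finsum`, `0` by convention when the signed traces are not finitely supported).
[cite: HatcherAT2002, §2.C (Lefschetz number)] [cite: Spanier1981, Ch. 4 §7] -/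
noncomputable def lefschetzNumber (φ : C ⟶ C) : K :=
  ∑ᶠ i, (c.χ i : ℤ) • LinearMap.trace K (C.homology i) (HomologicalComplex.homologyMap φ i).hom

/-! ### Hopf: the Lefschetz number at chain level -/

/-- **Hopf trace formula, read through the definition**: for finite-dimensional finitely supported terms,
`Λ(φ) = Σᶠ i, χ(i) • tr(φᵢ)`. [cite: HatcherAT2002, Thm. 2C.3] [cite: Spanier1981, Ch. 4 §7 Thm. 6] -/
theorem lefschetzNumber_eq_finsum_χ_smul_trace_f (φ : C ⟶ C) [∀ i, Module.Finite K (C.X i)]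
    (hC : (GradedObject.finrankSupport C.X).Finite) :
    lefschetzNumber φ = ∑ᶠ i, (c.χ i : ℤ) • LinearMap.trace K (C.X i) (φ.f i).hom :=
  (HopfTrace.finsum_χ_smul_trace_eq C φ hC).symm

/-- `Finset` form of Hopf: if the non-zero terms of `C` have indices in `s`, `Λ(φ) = Σ_{i ∈ s} χ(i) • tr(φᵢ)`.
[cite: HatcherAT2002, Thm. 2C.3] -/
theorem lefschetzNumber_eq_sum_χ_smul_trace_f (φ : C ⟶ C) [∀ i, Module.Finite K (C.X i)] (s : Finset ι)
    (hC : GradedObject.finrankSupport C.X ⊆ s) :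
    lefschetzNumber φ = ∑ i ∈ s, (c.χ i : ℤ) • LinearMap.trace K (C.X i) (φ.f i).hom := by
  have hfin : (GradedObject.finrankSupport C.X).Finite := s.finite_toSet.subset hC
  rw [lefschetzNumber_eq_finsum_χ_smul_trace_f φ hfin]
  refine finsum_eq_sum_of_support_subset _ fun i hi => ?_
  by_contra his
  have h0 : Module.finrank K (C.X i) = 0 := by
    by_contra hne
    exact his (hC (by simpa [GradedObject.finrankSupport] using hne))
  haveI : Subsingleton (C.X i) := Module.finrank_zero_iff.1 h0
  apply hi
  show (c.χ i : ℤ) • LinearMap.trace K (C.X i) (φ.f i).hom = 0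
  rw [Subsingleton.elim (φ.f i).hom 0, map_zero, smul_zero]

/-- Where `Hᵢ(C) = 0` the `i`-th signed trace vanishes; hence the signed traces are supported on the rank support of the
homology. [cite: HatcherAT2002, §2.C] -/
theorem support_χ_smul_trace_homologyMap_subset (φ : C ⟶ C) [∀ i, Module.Finite K (C.homology i)] :
    Function.support (fun i => (c.χ i : ℤ) • LinearMap.trace K (C.homology i) (HomologicalComplex.homologyMap φ i).hom) ⊆
      GradedObject.finrankSupport (fun i => C.homology i) := by
  intro i hi
  simp only [GradedObject.finrankSupport, Function.mem_support, ne_eq] at hi ⊢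
  intro h0
  haveI : Subsingleton (C.homology i) := Module.finrank_zero_iff.1 h0
  exact hi (by rw [Subsingleton.elim (HomologicalComplex.homologyMap φ i).hom 0, map_zero, smul_zero])

/-- `Finset` form of the definition: if the non-zero homology has indices in `s`, `Λ(φ) = Σ_{i ∈ s} χ(i) • tr(H(φ)ᵢ)`.
[cite: HatcherAT2002, §2.C] -/
theorem lefschetzNumber_eq_sum (φ : C ⟶ C) [∀ i, Module.Finite K (C.homology i)] (s : Finset ι)
    (hH : GradedObject.finrankSupport (fun i => C.homology i) ⊆ s) :
    lefschetzNumber φ = ∑ i ∈ s, (c.χ i : ℤ) • LinearMap.trace K (C.homology i) (HomologicalComplex.homologyMap φ i).hom :=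
  finsum_eq_sum_of_support_subset _ ((support_χ_smul_trace_homologyMap_subset φ).trans hH)

/-- **`Λ(𝟙 C) = χ_H(C)`**: the Lefschetz number of the identity is the homological Euler characteristic (cast to `K`), for
finite-dimensional finitely supported homology. [cite: HatcherAT2002, §2.C] -/
theorem lefschetzNumber_id (C : HomologicalComplex (ModuleCat.{v} K) c) [∀ i, Module.Finite K (C.homology i)]
    (hH : (GradedObject.finrankSupport (fun i => C.homology i)).Finite) :
    lefschetzNumber (𝟙 C) = (C.homologyEulerChar : K) := by
  have hsupp : (Function.support fun i => (c.χ i : ℤ) * (Module.finrank K (C.homology i) : ℤ)).Finite := by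
    refine hH.subset fun i hi => ?_
    simp only [GradedObject.finrankSupport, Function.mem_support, ne_eq] at hi ⊢
    intro h0
    exact hi (by rw [h0, Nat.cast_zero, mul_zero])
  rw [lefschetzNumber, HomologicalComplex.homologyEulerChar, GradedObject.eulerChar]
  have hcast := (Int.castAddHom K).map_finsum hsupp
  simp only [Int.coe_castAddHom] at hcast
  rw [hcast]
  refine finsum_congr fun i => ?_
  rw [Int.cast_mul, Int.cast_natCast, HomologicalComplex.homologyMap_id, ModuleCat.hom_id, LinearMap.trace_id,
    zsmul_eq_mul]

/-- Endomorphisms inducing degreewise the same traces on homology have the same Lefschetz number.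
[cite: HatcherAT2002, §2.C] -/
theorem lefschetzNumber_congr {φ ψ : C ⟶ C}
    (h : ∀ i, LinearMap.trace K (C.homology i) (HomologicalComplex.homologyMap φ i).hom =
      LinearMap.trace K (C.homology i) (HomologicalComplex.homologyMap ψ i).hom) :
    lefschetzNumber φ = lefschetzNumber ψ :=
  finsum_congr fun i => by rw [h i]

/-- **Homotopy invariance**: homotopic endomorphisms have the same Lefschetz number (they induce the same maps on homology,
Mathlib `Homotopy.homologyMap_eq`). [cite: HatcherAT2002, §2.C] [cite: Spanier1981, Ch. 4 §7] -/
theorem _root_.Homotopy.lefschetzNumber_eq {φ ψ : C ⟶ C} (h : Homotopy φ ψ) :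
    lefschetzNumber φ = lefschetzNumber ψ :=
  lefschetzNumber_congr fun i => by rw [h.homologyMap_eq i]

/-! ### `Λ(φ ≫ ψ) = Λ(ψ ≫ φ)` and invariance under quasi-isomorphic replacement -/

/-- **`Λ(φ ≫ ψ) = Λ(ψ ≫ φ)`** for `φ : C ⟶ D`, `ψ : D ⟶ C` (finite-dimensional homology on both sides; `tr(AB) = tr(BA)`).
[cite: HatcherAT2002, §2.C] -/
theorem lefschetzNumber_comp_comm (φ : C ⟶ D) (ψ : D ⟶ C) [∀ i, Module.Finite K (C.homology i)]
    [∀ i, Module.Finite K (D.homology i)] :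
    lefschetzNumber (φ ≫ ψ) = lefschetzNumber (ψ ≫ φ) := by
  refine finsum_congr fun i => ?_
  rw [HomologicalComplex.homologyMap_comp, HomologicalComplex.homologyMap_comp, ModuleCat.hom_comp, ModuleCat.hom_comp,
    LinearMap.trace_comp_comm']

/-- **Invariance under quasi-isomorphic replacement**: if `f : C ⟶ D` is a quasi-isomorphism intertwining `φ` and `ψ`
(`φ ≫ f = f ≫ ψ`), then `Λ(φ) = Λ(ψ)` (`H(ψ)` is conjugate to `H(φ)` by the isomorphism `H(f)`). No finiteness needed.
[cite: HatcherAT2002, §2.C] [cite: Spanier1981, Ch. 4 §7] -/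
theorem lefschetzNumber_eq_of_comm_quasiIso (f : C ⟶ D) [QuasiIso f] (φ : C ⟶ C) (ψ : D ⟶ D)
    (comm : φ ≫ f = f ≫ ψ) : lefschetzNumber φ = lefschetzNumber ψ := by
  refine finsum_congr fun i => ?_
  congr 1
  set e : C.homology i ≃ₗ[K] D.homology i := (isoOfQuasiIsoAt f i).toLinearEquiv with he
  have hconj : (HomologicalComplex.homologyMap ψ i).hom = e.conj (HomologicalComplex.homologyMap φ i).hom := by
    have hc : HomologicalComplex.homologyMap φ i ≫ HomologicalComplex.homologyMap f i =
        HomologicalComplex.homologyMap f i ≫ HomologicalComplex.homologyMap ψ i := by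
      rw [← HomologicalComplex.homologyMap_comp, ← HomologicalComplex.homologyMap_comp, comm]
    apply LinearMap.ext
    intro y
    obtain ⟨x, rfl⟩ := e.surjective y
    rw [LinearEquiv.conj_apply, LinearMap.comp_apply, LinearMap.comp_apply, LinearEquiv.coe_coe, LinearEquiv.coe_coe,
      e.symm_apply_apply]
    have hx := congrArg (fun g => g.hom x) hc
    simp only [ModuleCat.hom_comp, LinearMap.comp_apply] at hx
    rw [he, Iso.toLinearEquiv_apply, Iso.toLinearEquiv_apply, isoOfQuasiIsoAt_hom]
    exact hx.symm
  rw [hconj, LinearMap.trace_conj']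

/-- **Conjugation invariance**: `Λ(e⁻¹ ≫ φ ≫ e) = Λ(φ)` for an isomorphism of complexes `e : C ≅ D`.
[cite: HatcherAT2002, §2.C] -/
theorem lefschetzNumber_conj (e : C ≅ D) (φ : C ⟶ C) : lefschetzNumber (e.inv ≫ φ ≫ e.hom) = lefschetzNumber φ :=
  (lefschetzNumber_eq_of_comm_quasiIso e.hom φ (e.inv ≫ φ ≫ e.hom) (by simp)).symm

/-! ### Additivity in the endomorphism -/

/-- `Λ(0) = 0`. [cite: HatcherAT2002, §2.C] -/
theorem lefschetzNumber_zero : lefschetzNumber (0 : C ⟶ C) = 0 := by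
  rw [lefschetzNumber]
  refine (finsum_congr fun i => ?_).trans finsum_zero
  rw [HomologicalComplex.homologyMap_zero, ModuleCat.hom_zero, map_zero, smul_zero]

/-- `Λ(−φ) = −Λ(φ)`. [cite: HatcherAT2002, §2.C] -/
theorem lefschetzNumber_neg (φ : C ⟶ C) : lefschetzNumber (-φ) = -lefschetzNumber φ := by
  rw [lefschetzNumber, lefschetzNumber, ← finsum_neg_distrib]
  refine finsum_congr fun i => ?_
  rw [HomologicalComplex.homologyMap_neg, ModuleCat.hom_neg, map_neg, smul_neg]

/-- `Λ(φ + ψ) = Λ(φ) + Λ(ψ)` (finite-dimensional finitely supported homology). [cite: HatcherAT2002, §2.C] -/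
theorem lefschetzNumber_add (φ ψ : C ⟶ C) [∀ i, Module.Finite K (C.homology i)]
    (hH : (GradedObject.finrankSupport (fun i => C.homology i)).Finite) :
    lefschetzNumber (φ + ψ) = lefschetzNumber φ + lefschetzNumber ψ := by
  rw [lefschetzNumber, lefschetzNumber, lefschetzNumber,
    ← finsum_add_distrib (hH.subset (support_χ_smul_trace_homologyMap_subset φ))
      (hH.subset (support_χ_smul_trace_homologyMap_subset ψ))]
  refine finsum_congr fun i => ?_
  rw [HomologicalComplex.homologyMap_add, ModuleCat.hom_add, map_add, smul_add]

/-- `Λ(φ − ψ) = Λ(φ) − Λ(ψ)` (finite-dimensional finitely supported homology). [cite: HatcherAT2002, §2.C] -/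
theorem lefschetzNumber_sub (φ ψ : C ⟶ C) [∀ i, Module.Finite K (C.homology i)]
    (hH : (GradedObject.finrankSupport (fun i => C.homology i)).Finite) :
    lefschetzNumber (φ - ψ) = lefschetzNumber φ - lefschetzNumber ψ := by
  rw [sub_eq_add_neg, lefschetzNumber_add φ (-ψ) hH, lefschetzNumber_neg, sub_eq_add_neg]

omit [c.EulerCharSigns] in
/-- `Z(a • φ)ᵢ = a • Z(φ)ᵢ` on cycles, for the `K`-linear structure on morphisms of complexes of `K`-modules
(checked after the monomorphism `iCycles`). [cite: HatcherAT2002, §2.C] -/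
theorem cyclesMap_smul (a : K) (φ : C ⟶ D) (i : ι) :
    HomologicalComplex.cyclesMap (a • φ) i = a • HomologicalComplex.cyclesMap φ i := by
  rw [← cancel_mono (D.iCycles i), HomologicalComplex.cyclesMap_i, Linear.smul_comp, HomologicalComplex.cyclesMap_i,
    HomologicalComplex.smul_f_apply, Linear.comp_smul]

omit [c.EulerCharSigns] in
/-- `H(a • φ)ᵢ = a • H(φ)ᵢ` (checked before the epimorphism `homologyπ`). [cite: HatcherAT2002, §2.C] -/
theorem homologyMap_smul (a : K) (φ : C ⟶ D) (i : ι) :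
    HomologicalComplex.homologyMap (a • φ) i = a • HomologicalComplex.homologyMap φ i := by
  rw [← cancel_epi (C.homologyπ i), HomologicalComplex.homologyπ_naturality, Linear.comp_smul,
    HomologicalComplex.homologyπ_naturality, cyclesMap_smul, Linear.smul_comp]

/-- `Λ(a • φ) = a · Λ(φ)`. [cite: HatcherAT2002, §2.C] -/
theorem lefschetzNumber_smul (a : K) (φ : C ⟶ C) : lefschetzNumber (a • φ) = a * lefschetzNumber φ := by
  rw [lefschetzNumber, lefschetzNumber, mul_finsum]
  refine finsum_congr fun i => ?_
  rw [homologyMap_smul, ModuleCat.hom_smul, map_smul, smul_eq_mul, zsmul_eq_mul, zsmul_eq_mul, mul_left_comm]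

/-- An **acyclic** complex has `Λ(φ) = 0` for every endomorphism `φ`. [cite: HatcherAT2002, §2.C] -/
theorem lefschetzNumber_eq_zero_of_exactAt (hC : ∀ i, C.ExactAt i) (φ : C ⟶ C) : lefschetzNumber φ = 0 := by
  rw [lefschetzNumber]
  refine (finsum_congr fun i => ?_).trans finsum_zero
  haveI : Subsingleton (C.homology i) := ModuleCat.subsingleton_of_isZero ((hC i).isZero_homology)
  rw [Subsingleton.elim (HomologicalComplex.homologyMap φ i).hom 0, map_zero, smul_zero]

/-- A **null-homotopic** endomorphism has Lefschetz number `0`. [cite: HatcherAT2002, §2.C] -/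
theorem _root_.Homotopy.lefschetzNumber_eq_zero {φ : C ⟶ C} (h : Homotopy φ 0) : lefschetzNumber φ = 0 :=
  h.lefschetzNumber_eq.trans lefschetzNumber_zero

/-- **Chain-level shadow**: a null-homotopic endomorphism of a finitely supported complex of finite-dimensional spaces has
super-trace `Σᶠ i, χ(i) • tr(φᵢ) = 0` (Hopf + homotopy invariance). [cite: HatcherAT2002, Thm. 2C.3] -/
theorem finsum_χ_smul_trace_f_eq_zero_of_homotopy_zero {φ : C ⟶ C} (h : Homotopy φ 0) [∀ i, Module.Finite K (C.X i)]
    (hC : (GradedObject.finrankSupport C.X).Finite) :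
    ∑ᶠ i, (c.χ i : ℤ) • LinearMap.trace K (C.X i) (φ.f i).hom = 0 := by
  rw [← lefschetzNumber_eq_finsum_χ_smul_trace_f φ hC, h.lefschetzNumber_eq_zero]

end Literature.Algebra.Homology.Lefschetz

/-- **Hopf for a bounded cochain complex, through the definition**: if `Cⁿ = 0` outside `[a, b]` and `φ : C ⟶ C`,
`Λ(φ) = Σ_{n=a}^{b} (−1)ⁿ tr(φⁿ)`. [cite: HatcherAT2002, Thm. 2C.3] -/
theorem Literature.Algebra.Homology.CochainComplex.lefschetzNumber_eq_sum_Icc {K : Type u} [Field K]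
    (C : CochainComplex (ModuleCat.{v} K) ℤ) (φ : C ⟶ C) [∀ n, Module.Finite K (C.X n)] (a b : ℤ)
    (hC : ∀ n, n ∉ Finset.Icc a b → IsZero (C.X n)) :
    Literature.Algebra.Homology.Lefschetz.lefschetzNumber φ =
      ∑ n ∈ Finset.Icc a b, (n.negOnePow : ℤ) • LinearMap.trace K (C.X n) (φ.f n).hom := by
  have hsupp : GradedObject.finrankSupport C.X ⊆ (Finset.Icc a b : Finset ℤ) := by
    intro n hn
    by_contra hn'
    haveI := ModuleCat.subsingleton_of_isZero (hC n hn')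
    exact hn Module.finrank_zero_of_subsingleton
  simpa using Literature.Algebra.Homology.Lefschetz.lefschetzNumber_eq_sum_χ_smul_trace_f φ (Finset.Icc a b) hsupp
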